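import Summits.RiemannHypothesis.RiemannHypothesis.Theorems.TiltedLandingLaw421TwoSidedSocket

/-! # TiltedLandingLaw421TwoSidedClasses
c14 NAMED LEVEL CLASSES §Z (C1 rh-idea-5 g20): `LiftClass`, `SwitchClass`, `FlatClass`, `EntryClass`, `EmptyClass`, `SlowClass`, `HeredityExceptions`, `StateExitLaw ρ 𝓔` (state-level E⁺ outside 𝓔), `stateExitLaw_of_heredity` (K from `TentHereditySig`), `stateExitLaw_mono`, `…_of_heredity_cup`; §Lift (C4 rh-idea-6 g21, the sSup step state ⟶ meter): `tentAt_image_bddAbove`, `tentAt_le_tentMeterMax`, `tentMeterMax_eq_zero_of_no_lowest`, `tentMeterMax_succ_add_le_of_states`, `tentMeterMax_succ_add_le_of_no_succ`.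
SUPPORT module for crux `TiltedLandingLaw421` (stmt-RiemannHypothesis-24774), `--supports` only: proves no stub, no crux; fully proved (no `sorry`).
Packaged by C4 rh-idea-6 g21 per director (CA239)(1) in the (CA237) lint shape. RH is not proved. -/

namespace RhW07.C14.Classes

open Complex
open RhIdea6.G17.W07C7 RhIdea6.G17.W07C7.Rev6 RhIdea6.G18.W07C8.Law421BirthS RhIdea6.G19.W07C11.Seam
open RhIdea6.G20.W07C12.Frac RhIdea6.G20.W07C12.StColP RhW07.C12.FieldSplit RhIdea6.G20.W07C13pre.Tent RhIdea6.G21.W07C13.TentMax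
open RhW07.C13.Heredity RhW07.C14.TwoSided

/-- union of two exception classes. -/
def cup (𝓔₁ 𝓔₂ : LevelClass) : LevelClass := fun η f x₀ s hmax R Hs B j =>
  𝓔₁ η f x₀ s hmax R Hs B j ∨ 𝓔₂ η f x₀ s hmax R Hs B j

/-- LIFT (C6: 17 levels): some lowest state at level `j+1` is HIGHER than some lowest state at level `j`. -/
def LiftClass (St : StatePred) : LevelClass := fun η f x₀ s hmax R Hs B j =>
  ∃ u u' : ℂ, IsLowest St η f x₀ s hmax R Hs B j u ∧ IsLowest St η f x₀ s hmax R Hs B (j + 1) u' ∧ u.im < u'.im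

/-- SWITCH / LANDING (C6: 5 levels): some lowest state at level `j+1` is NO descendant of some lowest state `u` at level `j`
(not within `‖·‖ < Im u` of it — the tracked pair landed or the identity switched). -/
def SwitchClass (St : StatePred) : LevelClass := fun η f x₀ s hmax R Hs B j =>
  ∃ u u' : ℂ, IsLowest St η f x₀ s hmax R Hs B j u ∧ IsLowest St η f x₀ s hmax R Hs B (j + 1) u' ∧ u.im ≤ ‖u' - u‖

/-- FLAT / STACK (C6: 16 levels): a lowest state at level `j` or `j+1` has a NON-REAL companion in its ρ-tent (¬`RealTent`). -/
def FlatClass (ρ : ℝ) : LevelClass := fun η f x₀ s hmax R Hs B j =>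
  (∃ u : ℂ, IsLowest StCol' η f x₀ s hmax R Hs B j u ∧ ¬ RealTent ρ f j u) ∨
  (∃ u' : ℂ, IsLowest StCol' η f x₀ s hmax R Hs B (j + 1) u' ∧ ¬ RealTent ρ f (j + 1) u')

/-- ENTRY (C6: 15 levels, all at the FOOT): some new companion lies outside the real-part shadow of the old tent (¬`NoEntry`). -/
def EntryClass (ρ : ℝ) : LevelClass := fun η f x₀ s hmax R Hs B j =>
  ∃ u u' : ℂ, IsLowest StCol' η f x₀ s hmax R Hs B j u ∧ IsLowest StCol' η f x₀ s hmax R Hs B (j + 1) u' ∧ ¬ NoEntry ρ f j u u'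

/-- EMPTY: a lowest state at level `j` has tent count `< 1` (nothing to exit). -/
def EmptyClass (ρ : ℝ) : LevelClass := fun η f x₀ s hmax R Hs B j =>
  ∃ u : ℂ, IsLowest StCol' η f x₀ s hmax R Hs B j u ∧ tentAt ρ f j u < 1

/-- SLOW (the tables' alternative to FLAT, C6 ADD-21 (iii)): the tracked pair descends by `< θ·s` — for use under `∃ θ < 1` only (4c(iv)). -/
def SlowClass (θ : ℝ) : LevelClass := fun η f x₀ s hmax R Hs B j =>
  ∃ u u' : ℂ, IsLowest StCol' η f x₀ s hmax R Hs B j u ∧ IsLowest StCol' η f x₀ s hmax R Hs B (j + 1) u' ∧ u.im - u'.im < θ * s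

/-- the union of the five structural kinds = exactly the levels where some guard of §X (R) fails for some pair of lowest states. -/
def HeredityExceptions (ρ : ℝ) : LevelClass :=
  cup (LiftClass StCol') (cup (SwitchClass StCol') (cup (FlatClass ρ) (cup (EntryClass ρ) (EmptyClass ρ))))

/-- **STATE-LEVEL EXIT LAW outside 𝓔** for the reading `T = tentAt ρ`: at every level outside 𝓔, every lowest state at `j+1` has at least one
companion FEWER than every lowest state at `j` (net exit ≥ 1).  Research statement in general; for 𝓔 = `HeredityExceptions ρ` it follows from (R). -/
def StateExitLaw (ρ : ℝ) (𝓔 : LevelClass) : Prop :=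
  ∀ (η : ℝ) (f : ℂ → ℂ) (x₀ s hmax R Hs : ℝ) (B : ℕ), EngineHyps5 2 η f x₀ s hmax R Hs B →
    ∀ (j : ℕ) (u u' : ℂ), ¬ 𝓔 η f x₀ s hmax R Hs B j →
      IsLowest StCol' η f x₀ s hmax R Hs B j u → IsLowest StCol' η f x₀ s hmax R Hs B (j + 1) u' →
        tentAt ρ f (j + 1) u' ≤ tentAt ρ f j u - 1

/-- ★ (K) §X's guarded heredity (R) IS the state-level exit law outside the five named kinds. -/
theorem stateExitLaw_of_heredity {ρ : ℝ} (h : TentHereditySig ρ) : StateExitLaw ρ (HeredityExceptions ρ) := by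
  intro η f x₀ s hmax R Hs B hE j u u' hex hu hu'
  -- the class, spelled out (definitionally equal to `HeredityExceptions ρ η f x₀ s hmax R Hs B j`)
  have hex' : ¬ ((∃ a b : ℂ, IsLowest StCol' η f x₀ s hmax R Hs B j a ∧ IsLowest StCol' η f x₀ s hmax R Hs B (j + 1) b ∧ a.im < b.im) ∨
      ((∃ a b : ℂ, IsLowest StCol' η f x₀ s hmax R Hs B j a ∧ IsLowest StCol' η f x₀ s hmax R Hs B (j + 1) b ∧ a.im ≤ ‖b - a‖) ∨
      (((∃ a : ℂ, IsLowest StCol' η f x₀ s hmax R Hs B j a ∧ ¬ RealTent ρ f j a) ∨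
        (∃ b : ℂ, IsLowest StCol' η f x₀ s hmax R Hs B (j + 1) b ∧ ¬ RealTent ρ f (j + 1) b)) ∨
      ((∃ a b : ℂ, IsLowest StCol' η f x₀ s hmax R Hs B j a ∧ IsLowest StCol' η f x₀ s hmax R Hs B (j + 1) b ∧ ¬ NoEntry ρ f j a b) ∨
      (∃ a : ℂ, IsLowest StCol' η f x₀ s hmax R Hs B j a ∧ tentAt ρ f j a < 1))))) := hex
  have hnl : u'.im ≤ u.im := not_lt.mp fun hlt => hex' (Or.inl ⟨u, u', hu, hu', hlt⟩)
  have hdesc : ‖u' - u‖ < u.im := not_le.mp fun hge => hex' (Or.inr (Or.inl ⟨u, u', hu, hu', hge⟩))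
  have hreal : RealTent ρ f j u := by
    by_contra hn; exact hex' (Or.inr (Or.inr (Or.inl (Or.inl ⟨u, hu, hn⟩))))
  have hreal' : RealTent ρ f (j + 1) u' := by
    by_contra hn; exact hex' (Or.inr (Or.inr (Or.inl (Or.inr ⟨u', hu', hn⟩))))
  have hne : NoEntry ρ f j u u' := by
    by_contra hn; exact hex' (Or.inr (Or.inr (Or.inr (Or.inl ⟨u, u', hu, hu', hn⟩))))
  have hT : 1 ≤ tentAt ρ f j u := not_lt.mp fun hlt => hex' (Or.inr (Or.inr (Or.inr (Or.inr ⟨u, hu, hlt⟩))))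
  exact h η f x₀ s hmax R Hs B hE j u u' hu hu' hdesc hnl hreal hreal' hne hT

/-- (K) monotonicity: enlarging the exception class weakens the state-level exit law. -/
theorem stateExitLaw_mono {ρ : ℝ} {𝓔 𝓔' : LevelClass}
    (hsub : ∀ η f x₀ s hmax R Hs B j, 𝓔 η f x₀ s hmax R Hs B j → 𝓔' η f x₀ s hmax R Hs B j)
    (h : StateExitLaw ρ 𝓔) : StateExitLaw ρ 𝓔' :=
  fun η f x₀ s hmax R Hs B hE j u u' hex hu hu' => h η f x₀ s hmax R Hs B hE j u u' (fun he => hex (hsub _ _ _ _ _ _ _ _ _ he)) hu hu'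

/-- (K) in particular (R) gives the exit law outside the five kinds PLUS any further named class (e.g. `FootClass θ StCol'`, `SlowClass θ`). -/
theorem stateExitLaw_of_heredity_cup {ρ : ℝ} (𝓔 : LevelClass) (h : TentHereditySig ρ) :
    StateExitLaw ρ (cup (HeredityExceptions ρ) 𝓔) :=
  stateExitLaw_mono (fun _ _ _ _ _ _ _ _ _ he => Or.inl he) (stateExitLaw_of_heredity h)

end RhW07.C14.Classes

namespace RhIdea6.G21.W07C13.TentMax

open Complex Set
open RhIdea6.G17.W07C7 RhIdea6.G17.W07C7.Rev6 RhIdea6.G18.W07C8.Law421BirthS RhIdea6.G19.W07C11.Seam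
open RhIdea6.G20.W07C12.Frac RhIdea6.G20.W07C12.StColP RhW07.C12.FieldSplit RhIdea6.G20.W07C13pre.Tent

/-- (K) the readings of a level are bounded above (finitely many lowest states). -/
theorem tentAt_image_bddAbove {η : ℝ} {f : ℂ → ℂ} {x₀ s hmax R Hs : ℝ} {B : ℕ}
    (hE : EngineHyps5 2 η f x₀ s hmax R Hs B) (ρ : ℝ) (j : ℕ) :
    BddAbove (tentAt ρ f j '' {u : ℂ | IsLowest StCol' η f x₀ s hmax R Hs B j u}) :=
  ((isLowest_finite hE j).image (tentAt ρ f j)).bddAbove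

/-- (K) every lowest state's reading is below the sealed MAX meter of its level. -/
theorem tentAt_le_tentMeterMax {η : ℝ} {f : ℂ → ℂ} {x₀ s hmax R Hs : ℝ} {B : ℕ}
    (hE : EngineHyps5 2 η f x₀ s hmax R Hs B) (ρ : ℝ) {j : ℕ} {u : ℂ}
    (hu : IsLowest StCol' η f x₀ s hmax R Hs B j u) :
    tentAt ρ f j u ≤ tentMeterMax ρ η f x₀ s hmax R Hs B j :=
  le_csSup (tentAt_image_bddAbove hE ρ j) ⟨u, hu, rfl⟩

/-- (K) a level WITHOUT lowest states reads `0` on the sealed MAX meter. -/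
theorem tentMeterMax_eq_zero_of_no_lowest {η : ℝ} {f : ℂ → ℂ} {x₀ s hmax R Hs : ℝ} {B : ℕ} (ρ : ℝ) {j : ℕ}
    (h : ¬ ∃ v : ℂ, IsLowest StCol' η f x₀ s hmax R Hs B j v) :
    tentMeterMax ρ η f x₀ s hmax R Hs B j = 0 := by
  have hempty : tentAt ρ f j '' {u : ℂ | IsLowest StCol' η f x₀ s hmax R Hs B j u} = ∅ := by
    ext t
    simp only [Set.mem_image, Set.mem_setOf_eq, Set.mem_empty_iff_false, iff_false]
    rintro ⟨u, hu, -⟩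
    exact h ⟨u, hu⟩
  unfold tentMeterMax
  rw [hempty, Real.sSup_empty]

/-- ★ (K) THE sSup STEP (state level ⟶ meter level; C1 TYPING-4 «the sSup step to meter level is C4's»): if EVERY pair of
lowest `StCol'` states `u` (level `j`) and `u'` (level `j+1`) satisfies `T_{j+1}(u') + c ≤ T_j(u)`, and both levels carry a
lowest state, then the sealed MAX meter drops by at least `c`: `T^max_{j+1} + c ≤ T^max_j`.  (`c = 1` = the exit law at a
charged level; `c = 0` = no rise at an uncharged level; negative `c` = a bounded rise on a named exception level.) -/
theorem tentMeterMax_succ_add_le_of_states {η : ℝ} {f : ℂ → ℂ} {x₀ s hmax R Hs : ℝ} {B : ℕ}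
    (hE : EngineHyps5 2 η f x₀ s hmax R Hs B) {ρ c : ℝ} {j : ℕ}
    (hlaw : ∀ u u' : ℂ, IsLowest StCol' η f x₀ s hmax R Hs B j u → IsLowest StCol' η f x₀ s hmax R Hs B (j + 1) u' →
      tentAt ρ f (j + 1) u' + c ≤ tentAt ρ f j u)
    (hne : ∃ v : ℂ, IsLowest StCol' η f x₀ s hmax R Hs B j v)
    (hne' : ∃ v' : ℂ, IsLowest StCol' η f x₀ s hmax R Hs B (j + 1) v') :
    tentMeterMax ρ η f x₀ s hmax R Hs B (j + 1) + c ≤ tentMeterMax ρ η f x₀ s hmax R Hs B j := by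
  obtain ⟨v, hv⟩ := hne
  obtain ⟨v', hv'⟩ := hne'
  obtain ⟨u', hu', hmax'⟩ := tentMeterMax_attained (ρ := ρ) hE hv'
  rw [hmax']
  exact (hlaw v u' hv hu').trans (tentAt_le_tentMeterMax hE ρ hv)

/-- (K) the same with an EMPTY successor level: then `T^max_{j+1} = 0`, so `T^max_{j+1} + c ≤ T^max_j` as soon as
`c ≤ T_j(v)` for some lowest state `v` of level `j` (e.g. `c ≤ 0`, or `c = 1 ≤ T_j(v)` on a non-`EmptyClass` level). -/
theorem tentMeterMax_succ_add_le_of_no_succ {η : ℝ} {f : ℂ → ℂ} {x₀ s hmax R Hs : ℝ} {B : ℕ}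
    (hE : EngineHyps5 2 η f x₀ s hmax R Hs B) {ρ c : ℝ} {j : ℕ}
    (hne' : ¬ ∃ v' : ℂ, IsLowest StCol' η f x₀ s hmax R Hs B (j + 1) v')
    {v : ℂ} (hv : IsLowest StCol' η f x₀ s hmax R Hs B j v) (hc : c ≤ tentAt ρ f j v) :
    tentMeterMax ρ η f x₀ s hmax R Hs B (j + 1) + c ≤ tentMeterMax ρ η f x₀ s hmax R Hs B j := by
  rw [tentMeterMax_eq_zero_of_no_lowest ρ hne', zero_add]
  exact hc.trans (tentAt_le_tentMeterMax hE ρ hv)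

end RhIdea6.G21.W07C13.TentMax
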